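import Summits.HubbardSuperconductivity.HubbardSuperconductivity.Theorems.JosephsonMirrorFeynmanHellmann
import Summits.HubbardSuperconductivity.HubbardSuperconductivity.Theorems.JosephsonMirrorMirrorSymmetry
import Summits.HubbardSuperconductivity.HubbardSuperconductivity.Theorems.JosephsonMirrorWindowGibbsEntropy
import Literature.MathematicalPhysics.QuantumLattice.GibbsLinearResponse

/-!
# Route `JosephsonMirror` — the thermofield double of the window problem

Helper file (`--supports` stmt-HubbardSuperconductivity-2228, crux `JmCusp`) for route `JosephsonMirror`
(sub-problem `HubbardSuperconductivity`): the glue of the crux idea `thermofield-double-purification`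
(`Cruxes/JmCusp/Ideas/thermofield-double-purification.md`, typed as `TfdRayleigh` / `TfdLine` in
`Cruxes/JmCusp/SketchIdeator2.lean`), in abstract form.  For a Hermitian `A`, an arbitrary `D`, and the
window `S` of two-layer vectors supported on same-block pairs of two disjoint coordinate blocks `P₁`, `P₂`
that `A` leaves invariant (`A` commutes with both indicator diagonals), Lieb's `W`-matrix packaging of the
window double `H(J) = A ⊗ 1 + 1 ⊗ Aᵀ - J (D ⊗ D̄ + Dᴴ ⊗ D̄ᴴ)` is tested with the THERMOFIELD-DOUBLE matrix
`W = e^{-βA/2} Π` (`Π` the indicator diagonal of `P₁ ∪ P₂`):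

* `tfd_rayleigh` — the thermofield Rayleigh bound
  `E(J) · Re tr(Π e^{-βA}) ≤ 2 Re tr(Π A e^{-βA}) - 2J · Re tr(Π e^{-βA/2} D Π e^{-βA/2} Dᴴ)`:
  the norm of `ψ_W` is the window partition function, its unperturbed energy twice the window Gibbs
  energy, and its interlayer pair coherence is the imaginary-time pair correlator of ONE layer at
  separation `β/2`;
* `tfd_gain_lower` — composition with the window floor `E(0) ≥ 2a` and the entropy price
  (`re_trace_proj_hamiltonian_gibbsWeight_le`, file `Theorems/JosephsonMirrorWindowGibbsEntropy`):
  `2J · Re tr(Π e^{-βA/2} D Π e^{-βA/2} Dᴴ) - 2 (log(dim)/β) · Re tr(Π e^{-βA}) ≤ (E(0) - E(J)) · Re tr(Π e^{-βA})`,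
  i.e. cold single-layer two-time pair coherence gives linear Josephson gain up to `2 log(dim)/β`.

The Hubbard specialisation (cold imaginary-time `d`-wave pair coherence of one layer ⇒ clause (i) of
`JmCusp`) is `Theorems/JosephsonMirrorJmCuspThermofieldBridge`.

Sources: E. H. Lieb, Phys. Rev. Lett. 62 (1989) 1201, eq. (4) (the `W`-matrix packaging); Y. Takahashi,
H. Umezawa, Collect. Phenom. 2 (1975) 55 (thermofield double `W = e^{-βH/2}`); H. Tasaki, *Physics and
Mathematics of Quantum Many-Body Systems* (2020), App. A; T. Koma, H. Tasaki, J. Stat. Phys. 76 (1994)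
745.  No new definitions.
-/

-- the mandated namespace `Summit.<Summit>.<Problem>.Theorems` repeats `HubbardSuperconductivity`
-- (single-problem summit, D-0017), which the `dupNamespace` linter flags on every declaration
set_option linter.dupNamespace false

namespace Summit.HubbardSuperconductivity.HubbardSuperconductivity.Theorems.JosephsonMirror

open Matrix Literature.MathematicalPhysics.QuantumLattice
open scoped Kronecker ComplexOrder Matrix.Norms.L2Operator

variable {ι : Type*} [Fintype ι] [DecidableEq ι]

/-! ### Indicator diagonals -/

omit [Fintype ι] in
/-- The indicator diagonal of a union of two disjoint blocks is the sum of the two indicator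
diagonals. [folklore] -/
theorem diagonal_indicator_or (P₁ P₂ : ι → Prop) [DecidablePred P₁] [DecidablePred P₂]
    (h12 : ∀ s, P₁ s → ¬ P₂ s) :
    (diagonal fun s => if P₁ s ∨ P₂ s then (1 : ℂ) else 0) =
      (diagonal fun s => if P₁ s then (1 : ℂ) else 0) + diagonal fun s => if P₂ s then (1 : ℂ) else 0 := by
  rw [diagonal_add]
  congr 1
  funext s
  by_cases h1 : P₁ s
  · simp [h1, h12 s h1]
  · by_cases h2 : P₂ s <;> simp [h1, h2]

omit [Fintype ι] in
/-- An indicator diagonal is a Hermitian idempotent. [folklore] -/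
theorem diagonal_indicator_mul_self (w : ι → Prop) [DecidablePred w] [Fintype ι] :
    (diagonal fun s => if w s then (1 : ℂ) else 0) * (diagonal fun s => if w s then (1 : ℂ) else 0) =
      diagonal fun s => if w s then (1 : ℂ) else 0 := by
  rw [diagonal_mul_diagonal]
  congr 1
  funext s
  by_cases h : w s <;> simp [h]

omit [Fintype ι] in
/-- An indicator diagonal is Hermitian. [folklore] -/
theorem diagonal_indicator_conjTranspose (w : ι → Prop) [DecidablePred w] :
    (diagonal fun s => if w s then (1 : ℂ) else 0)ᴴ = diagonal fun s => if w s then (1 : ℂ) else 0 := by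
  rw [diagonal_conjTranspose]
  congr 1
  funext s
  by_cases h : w s <;> simp [h]

/-- Off-block entries of a matrix commuting with a block indicator vanish: if `M` commutes with
`diag 𝟙_P` then `M s t = 0` whenever `P t` and `¬ P s`. [folklore] -/
theorem apply_eq_zero_of_commute_indicator {M : Matrix ι ι ℂ} (P₁ : ι → Prop) [DecidablePred P₁]
    (hc : Commute M (diagonal fun s => if P₁ s then (1 : ℂ) else 0)) {s t : ι} (ht : P₁ t)
    (hs : ¬ P₁ s) : M s t = 0 := by
  have h := congrFun (congrFun hc.eq s) t
  rw [mul_diagonal, diagonal_mul, if_pos ht, if_neg hs, mul_one, zero_mul] at h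
  exact h

/-- **The thermofield Rayleigh bound.**  Let `A` be Hermitian, `D` arbitrary, `P₁`, `P₂` disjoint
coordinate blocks whose indicator diagonals commute with `A`, `S` the window of two-layer vectors
supported on pairs that are `good`, where every same-block pair is good, and `Π` the indicator diagonal
of `P₁ ∪ P₂`.  Testing the window double `H(J) = A ⊗ 1 + 1 ⊗ Aᵀ - J (D ⊗ D̄ + Dᴴ ⊗ D̄ᴴ)` with Lieb's
packaged vector `ψ_W`, `W = e^{-βA/2} Π` (the thermofield double of the window Gibbs state; it lies in
`S` because `e^{-βA/2}` is block diagonal), gives for all real `β`, `J`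
`E(J) · Re tr(Π e^{-βA}) ≤ 2 Re tr(Π A e^{-βA}) - 2J · Re tr(Π e^{-βA/2} D Π e^{-βA/2} Dᴴ)`:
the norm of `ψ_W` is the window partition function, its unperturbed energy twice the window Gibbs
energy, and its interlayer pair coherence the imaginary-time pair correlator of ONE layer at separation
`β/2` (the two Kronecker coupling terms are complex conjugate).  Lieb, PRL 62 (1989) 1201, eq. (4);
Takahashi–Umezawa (1975). [folklore] -/
theorem tfd_rayleigh {A : Matrix ι ι ℂ} (hA : A.IsHermitian) (D : Matrix ι ι ℂ)
    (P₁ P₂ : ι → Prop) [DecidablePred P₁] [DecidablePred P₂] (h12 : ∀ s, P₁ s → ¬ P₂ s)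
    (good : ι × ι → Prop)
    (hgood₁ : ∀ s t, P₁ s → P₁ t → good (s, t)) (hgood₂ : ∀ s t, P₂ s → P₂ t → good (s, t))
    (S : Submodule ℂ (ι × ι → ℂ)) (hS : ∀ ψ, ψ ∈ S ↔ ∀ p, ¬ good p → ψ p = 0)
    (hc₁ : Commute A (diagonal fun s => if P₁ s then (1 : ℂ) else 0))
    (hc₂ : Commute A (diagonal fun s => if P₂ s then (1 : ℂ) else 0)) (β J : ℝ) :
    (A ⊗ₖ (1 : Matrix ι ι ℂ) + (1 : Matrix ι ι ℂ) ⊗ₖ Aᵀ -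
          (J : ℂ) • (D ⊗ₖ Dᴴᵀ + Dᴴ ⊗ₖ Dᵀ)).minEnergyOn S *
        ((diagonal fun s => if P₁ s ∨ P₂ s then (1 : ℂ) else 0) * gibbsWeight β A).trace.re ≤
      2 * ((diagonal fun s => if P₁ s ∨ P₂ s then (1 : ℂ) else 0) * A * gibbsWeight β A).trace.re -
        2 * J * ((diagonal fun s => if P₁ s ∨ P₂ s then (1 : ℂ) else 0) * gibbsWeight (β / 2) A * D *
          (diagonal fun s => if P₁ s ∨ P₂ s then (1 : ℂ) else 0) * gibbsWeight (β / 2) A * Dᴴ).trace.re := by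
  set Pw : Matrix ι ι ℂ := diagonal fun s => if P₁ s ∨ P₂ s then (1 : ℂ) else 0 with hPw
  set g : Matrix ι ι ℂ := gibbsWeight (β / 2) A with hg
  set g2 : Matrix ι ι ℂ := gibbsWeight β A with hg2
  -- algebra of the window indicator and the Gibbs weights
  have hPw12 : Pw = (diagonal fun s => if P₁ s then (1 : ℂ) else 0) +
      diagonal fun s => if P₂ s then (1 : ℂ) else 0 := diagonal_indicator_or P₁ P₂ h12
  have hAPw : Commute A Pw := by rw [hPw12]; exact hc₁.add_right hc₂
  have hPwPw : Pw * Pw = Pw := diagonal_indicator_mul_self _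
  have hPwH : Pwᴴ = Pw := diagonal_indicator_conjTranspose _
  have hgH : gᴴ = g := (isHermitian_gibbsWeight (β / 2) hA).eq
  have hgPw : Commute g Pw := by
    rw [hg]; unfold gibbsWeight; exact (hAPw.smul_left _).exp_left
  have hg1 : Commute g (diagonal fun s => if P₁ s then (1 : ℂ) else 0) := by
    rw [hg]; unfold gibbsWeight; exact (hc₁.smul_left _).exp_left
  have hg2' : Commute g (diagonal fun s => if P₂ s then (1 : ℂ) else 0) := by
    rw [hg]; unfold gibbsWeight; exact (hc₂.smul_left _).exp_left
  have hAg : Commute A g := by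
    rw [hg]; unfold gibbsWeight; exact ((Commute.refl A).smul_right _).exp_right
  have hgg : g * g = g2 := by
    rw [hg, hg2, gibbsWeight_mul_gibbsWeight, add_halves]
  -- the trial matrix and its support
  set W : Matrix ι ι ℂ := g * Pw with hW
  have hWapply : ∀ s t, W s t = g s t * (if P₁ t ∨ P₂ t then (1 : ℂ) else 0) := fun s t => by
    rw [hW, hPw, mul_diagonal]
  have hWS : (fun p : ι × ι => W p.1 p.2) ∈ S := by
    refine (hS _).2 fun p hp => ?_
    obtain ⟨s, t⟩ := p
    change W s t = 0
    rw [hWapply]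
    by_cases h1 : P₁ t
    · have hs : ¬ P₁ s := fun hs => hp (hgood₁ s t hs h1)
      rw [apply_eq_zero_of_commute_indicator P₁ hg1 h1 hs, zero_mul]
    · by_cases h2 : P₂ t
      · have hs : ¬ P₂ s := fun hs => hp (hgood₂ s t hs h2)
        rw [apply_eq_zero_of_commute_indicator P₂ hg2' h2 hs, zero_mul]
      · rw [if_neg (not_or.2 ⟨h1, h2⟩), mul_zero]
  -- the homogeneous Rayleigh bound for `ψ_W`
  have hR := minEnergyOn_mul_self_le (isHermitian_windowDouble hA D J) S hWS
  rw [star_vec_dotProduct_windowDouble_mulVec_vec, star_vec_dotProduct_vec] at hR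
  -- the four traces
  have hWH : Wᴴ = Pw * g := by rw [hW, conjTranspose_mul, hPwH, hgH]
  have hg2Pw : g2 * Pw = Pw * g2 := by
    rw [← hgg, Matrix.mul_assoc, hgPw.eq, ← Matrix.mul_assoc, hgPw.eq, Matrix.mul_assoc]
  have hAg2 : A * g2 = g2 * A := by
    rw [← hgg, ← Matrix.mul_assoc, hAg.eq, Matrix.mul_assoc, hAg.eq, Matrix.mul_assoc]
  have hnorm : hsInner W W = (Pw * g2).trace := by
    rw [hsInner, hWH, hW, Matrix.mul_assoc, ← Matrix.mul_assoc g g Pw, hgg, hg2Pw,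
      ← Matrix.mul_assoc, hPwPw]
  have hT1 : (Wᴴ * (A * W)).trace = (Pw * A * g2).trace := by
    rw [hWH, hW]
    have h : Pw * g * (A * (g * Pw)) = Pw * A * g2 * Pw := by
      rw [← hgg]
      calc Pw * g * (A * (g * Pw)) = Pw * (g * A) * g * Pw := by simp only [Matrix.mul_assoc]
        _ = Pw * (A * g) * g * Pw := by rw [hAg.eq]
        _ = Pw * A * (g * g) * Pw := by simp only [Matrix.mul_assoc]
    rw [h, trace_mul_cycle, ← Matrix.mul_assoc, hPwPw]
  have hT2 : (Wᴴ * (W * A)).trace = (Pw * A * g2).trace := by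
    rw [hWH, hW]
    have h : Pw * g * (g * Pw * A) = Pw * A * g2 := by
      calc Pw * g * (g * Pw * A) = Pw * (g * g) * Pw * A := by simp only [Matrix.mul_assoc]
        _ = Pw * (g2 * Pw) * A := by rw [hgg, Matrix.mul_assoc Pw g2 Pw]
        _ = Pw * Pw * g2 * A := by rw [hg2Pw, ← Matrix.mul_assoc]
        _ = Pw * (A * g2) := by rw [hPwPw, Matrix.mul_assoc, ← hAg2]
        _ = Pw * A * g2 := by rw [Matrix.mul_assoc]
    rw [h]
  have hT3 : (Wᴴ * (D * W * Dᴴ)).trace = (Pw * g * D * Pw * g * Dᴴ).trace := by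
    rw [hWH, hW, hgPw.eq]
    simp only [Matrix.mul_assoc]
  have hT4 : (Wᴴ * (Dᴴ * W * D)).trace = star (Pw * g * D * Pw * g * Dᴴ).trace := by
    rw [← trace_conjTranspose, hWH, hW, hgPw.eq]
    simp only [conjTranspose_mul, conjTranspose_conjTranspose, hPwH, hgH, Matrix.mul_assoc]
    calc (Pw * (g * (Dᴴ * (Pw * (g * D))))).trace = (Pw * (g * (Dᴴ * (Pw * g))) * D).trace := by
          simp only [Matrix.mul_assoc]
      _ = (D * (Pw * (g * (Dᴴ * (Pw * g))))).trace := trace_mul_comm _ _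
      _ = (D * (g * (Pw * (Dᴴ * (g * Pw))))).trace := by
          rw [← Matrix.mul_assoc Pw g, ← hgPw.eq]
          simp only [Matrix.mul_assoc]
  -- assemble the Rayleigh quotient
  have hnum : hsInner W (A * W + W * A - (J : ℂ) • (D * W * Dᴴ + Dᴴ * W * D)) =
      (Pw * A * g2).trace + (Pw * A * g2).trace -
        (J : ℂ) * ((Pw * g * D * Pw * g * Dᴴ).trace + star (Pw * g * D * Pw * g * Dᴴ).trace) := by
    rw [hsInner, Matrix.mul_sub, Matrix.mul_add, Matrix.mul_smul, Matrix.mul_add, trace_sub,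
      trace_add, trace_smul, trace_add, hT1, hT2, hT3, hT4, smul_eq_mul]
  rw [hnorm, hnum, Complex.sub_re, Complex.add_re, Complex.re_ofReal_mul, Complex.add_re,
    Complex.star_def, Complex.conj_re] at hR
  have h2 : ((Pw * A * g2).trace.re + (Pw * A * g2).trace.re -
      J * ((Pw * g * D * Pw * g * Dᴴ).trace.re + (Pw * g * D * Pw * g * Dᴴ).trace.re)) =
      2 * (Pw * A * g2).trace.re - 2 * J * (Pw * g * D * Pw * g * Dᴴ).trace.re := by ring
  rw [h2] at hR
  exact hR

/-! ### Composition: cold two-time pair coherence gives linear Josephson gain -/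

/-- **Cold two-time pair coherence ⇒ linear Josephson gain, up to the entropy price** (the line of
the idea `thermofield-double-purification`, abstract form).  In the setting of `tfd_rayleigh`, assume
moreover that the window consists exactly of the same-block pairs, that `A ≥ a` on each block
(Rayleigh floors) and that the floor `a` is attained, up to `≤`, by a unit vector of the first block.
Then for `β > 0` and every real `J`
`2J · Re tr(Π e^{-βA/2} D Π e^{-βA/2} Dᴴ) - 2 (log(card ι)/β) · Re tr(Π e^{-βA}) ≤ (E(0) - E(J)) · Re tr(Π e^{-βA})`:
the window floor `E(0) ≥ 2a` (block-wise, as in `gain_le_minEnergyOn_sub`), the thermofield Rayleigh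
bound `tfd_rayleigh` for `E(J)`, and the entropy price `re_trace_proj_hamiltonian_gibbsWeight_le` for the
unperturbed energy of the thermofield double.  So interlayer-free, single-layer imaginary-time pair
coherence `Re tr(Π e^{-βA/2} D Π e^{-βA/2} Dᴴ) ≥ κ · Re tr(Π e^{-βA})` forces the Josephson gain
`E(0) - E(J) ≥ 2Jκ - 2 log(dim)/β`.  Lieb, PRL 62 (1989) 1201; Tasaki (2020) App. A; Koma–Tasaki,
J. Stat. Phys. 76 (1994) 745. [folklore] -/
theorem tfd_gain_lower {A : Matrix ι ι ℂ} (hA : A.IsHermitian) (D : Matrix ι ι ℂ)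
    (P₁ P₂ : ι → Prop) [DecidablePred P₁] [DecidablePred P₂] (h12 : ∀ s, P₁ s → ¬ P₂ s)
    (good : ι × ι → Prop) (hgood : ∀ s t, good (s, t) → (P₁ s ∧ P₁ t) ∨ (P₂ s ∧ P₂ t))
    (hgood₁ : ∀ s t, P₁ s → P₁ t → good (s, t)) (hgood₂ : ∀ s t, P₂ s → P₂ t → good (s, t))
    (S : Submodule ℂ (ι × ι → ℂ)) (hS : ∀ ψ, ψ ∈ S ↔ ∀ p, ¬ good p → ψ p = 0)
    (hc₁ : Commute A (diagonal fun s => if P₁ s then (1 : ℂ) else 0))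
    (hc₂ : Commute A (diagonal fun s => if P₂ s then (1 : ℂ) else 0))
    (a : ℝ)
    (hA₁ : ∀ v : ι → ℂ, (∀ s, ¬ P₁ s → v s = 0) → a * (star v ⬝ᵥ v).re ≤ (star v ⬝ᵥ A *ᵥ v).re)
    (hA₂ : ∀ v : ι → ℂ, (∀ s, ¬ P₂ s → v s = 0) → a * (star v ⬝ᵥ v).re ≤ (star v ⬝ᵥ A *ᵥ v).re)
    (hatt : ∃ v : ι → ℂ, (∀ s, ¬ P₁ s → v s = 0) ∧ star v ⬝ᵥ v = 1 ∧ (star v ⬝ᵥ A *ᵥ v).re ≤ a)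
    {β : ℝ} (hβ : 0 < β) (J : ℝ) :
    2 * J * ((diagonal fun s => if P₁ s ∨ P₂ s then (1 : ℂ) else 0) * gibbsWeight (β / 2) A * D *
          (diagonal fun s => if P₁ s ∨ P₂ s then (1 : ℂ) else 0) * gibbsWeight (β / 2) A * Dᴴ).trace.re -
        2 * (Real.log (Fintype.card ι) / β) *
          ((diagonal fun s => if P₁ s ∨ P₂ s then (1 : ℂ) else 0) * gibbsWeight β A).trace.re ≤
      ((A ⊗ₖ (1 : Matrix ι ι ℂ) + (1 : Matrix ι ι ℂ) ⊗ₖ Aᵀ -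
            ((0 : ℝ) : ℂ) • (D ⊗ₖ Dᴴᵀ + Dᴴ ⊗ₖ Dᵀ)).minEnergyOn S -
          (A ⊗ₖ (1 : Matrix ι ι ℂ) + (1 : Matrix ι ι ℂ) ⊗ₖ Aᵀ -
            (J : ℂ) • (D ⊗ₖ Dᴴᵀ + Dᴴ ⊗ₖ Dᵀ)).minEnergyOn S) *
        ((diagonal fun s => if P₁ s ∨ P₂ s then (1 : ℂ) else 0) * gibbsWeight β A).trace.re := by
  set Pw : Matrix ι ι ℂ := diagonal fun s => if P₁ s ∨ P₂ s then (1 : ℂ) else 0 with hPw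
  set H₀ : Matrix (ι × ι) (ι × ι) ℂ := A ⊗ₖ (1 : Matrix ι ι ℂ) + (1 : Matrix ι ι ℂ) ⊗ₖ Aᵀ with hH₀
  set K : Matrix (ι × ι) (ι × ι) ℂ := D ⊗ₖ Dᴴᵀ + Dᴴ ⊗ₖ Dᵀ with hK
  obtain ⟨v, hvP, hv1, hva⟩ := hatt
  -- algebra of the window indicator
  have hPw12 : Pw = (diagonal fun s => if P₁ s then (1 : ℂ) else 0) +
      diagonal fun s => if P₂ s then (1 : ℂ) else 0 := diagonal_indicator_or P₁ P₂ h12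
  have hAPw : Commute A Pw := by rw [hPw12]; exact hc₁.add_right hc₂
  have hPwPw : Pw * Pw = Pw := diagonal_indicator_mul_self _
  have hPwH : Pw.IsHermitian := diagonal_indicator_conjTranspose _
  -- (1) the window floor `2a ≤ E(0)` (block-wise, as in `gain_le_minEnergyOn_sub`)
  have hblock : ∀ w : ι → ℂ, ((∀ t, ¬ P₁ t → w t = 0) ∨ (∀ t, ¬ P₂ t → w t = 0)) →
      a * (star w ⬝ᵥ w).re ≤ (star w ⬝ᵥ A *ᵥ w).re := by
    intro w hw
    rcases hw with hw | hw
    · exact hA₁ w hw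
    · exact hA₂ w hw
  have hcol : ∀ ψ ∈ S, ∀ t, (∀ s, ¬ P₁ s → ψ (s, t) = 0) ∨ (∀ s, ¬ P₂ s → ψ (s, t) = 0) := by
    intro ψ hψ t
    have hz : ∀ s, ¬ good (s, t) → ψ (s, t) = 0 := fun s hs => (hS ψ).1 hψ (s, t) hs
    by_cases h1 : P₁ t
    · refine Or.inl fun s hs => hz s fun hg => ?_
      rcases hgood s t hg with ⟨hs', -⟩ | ⟨-, ht'⟩
      · exact hs hs'
      · exact h12 t h1 ht'
    · by_cases h2 : P₂ t
      · refine Or.inr fun s hs => hz s fun hg => ?_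
        rcases hgood s t hg with ⟨-, ht'⟩ | ⟨hs', -⟩
        · exact h1 ht'
        · exact hs hs'
      · refine Or.inl fun s _ => hz s fun hg => ?_
        rcases hgood s t hg with ⟨-, ht'⟩ | ⟨-, ht'⟩
        · exact h1 ht'
        · exact h2 ht'
  have hrow : ∀ ψ ∈ S, ∀ s, (∀ t, ¬ P₁ t → ψ (s, t) = 0) ∨ (∀ t, ¬ P₂ t → ψ (s, t) = 0) := by
    intro ψ hψ s
    have hz : ∀ t, ¬ good (s, t) → ψ (s, t) = 0 := fun t ht => (hS ψ).1 hψ (s, t) ht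
    by_cases h1 : P₁ s
    · refine Or.inl fun t ht => hz t fun hg => ?_
      rcases hgood s t hg with ⟨-, ht'⟩ | ⟨hs', -⟩
      · exact ht ht'
      · exact h12 s h1 hs'
    · by_cases h2 : P₂ s
      · refine Or.inr fun t ht => hz t fun hg => ?_
        rcases hgood s t hg with ⟨hs', -⟩ | ⟨-, ht'⟩
        · exact h1 hs'
        · exact ht ht'
      · refine Or.inl fun t _ => hz t fun hg => ?_
        rcases hgood s t hg with ⟨hs', -⟩ | ⟨hs', -⟩
        · exact h1 hs'
        · exact h2 hs'
  have hlow : ∀ ψ ∈ S, 2 * a * (star ψ ⬝ᵥ ψ).re ≤ (star ψ ⬝ᵥ H₀ *ᵥ ψ).re := by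
    intro ψ hψ
    have hc : a * (star ψ ⬝ᵥ ψ).re ≤ (star ψ ⬝ᵥ (A ⊗ₖ (1 : Matrix ι ι ℂ)) *ᵥ ψ).re := by
      rw [star_dotProduct_kronecker_one_mulVec, star_dotProduct_self_eq_sum_cols, Complex.re_sum,
        Complex.re_sum, Finset.mul_sum]
      exact Finset.sum_le_sum fun t _ => hblock _ (hcol ψ hψ t)
    have hr : a * (star ψ ⬝ᵥ ψ).re ≤ (star ψ ⬝ᵥ ((1 : Matrix ι ι ℂ) ⊗ₖ Aᵀ) *ᵥ ψ).re := by
      rw [star_dotProduct_one_kronecker_mulVec, star_dotProduct_self_eq_sum_rows, Complex.re_sum,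
        Complex.re_sum, Finset.mul_sum]
      refine Finset.sum_le_sum fun s _ => ?_
      rw [star_dotProduct_transpose_mulVec, ← star_star_dotProduct_star_self]
      refine hblock (star fun t => ψ (s, t)) ?_
      rcases hrow ψ hψ s with h | h
      · exact Or.inl fun t ht => by simp [h t ht]
      · exact Or.inr fun t ht => by simp [h t ht]
    rw [hH₀, add_mulVec, dotProduct_add, Complex.add_re]
    linarith
  -- a unit vector of the window: `v ⊗ v̄`
  set u : ι × ι → ℂ := fun p : ι × ι => v p.1 * (star v) p.2 with hu
  have huS : u ∈ S := by
    refine (hS u).2 fun p hp => ?_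
    obtain ⟨s, t⟩ := p
    change v s * (star v) t = 0
    by_cases hs : P₁ s
    · by_cases ht : P₁ t
      · exact absurd (hgood₁ s t hs ht) hp
      · rw [Pi.star_apply, hvP t ht, star_zero, mul_zero]
    · rw [hvP s hs, zero_mul]
  have hu1 : star u ⬝ᵥ u = 1 := by
    rw [hu, star_tensor_conj_dotProduct, hv1, map_one, Complex.ofReal_one]
  have hE0 : 2 * a ≤ (H₀ - ((0 : ℝ) : ℂ) • K).minEnergyOn S := by
    rw [Complex.ofReal_zero, zero_smul, sub_zero]
    refine le_csInf ⟨(star u ⬝ᵥ H₀ *ᵥ u).re, u, huS, hu1, rfl⟩ ?_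
    rintro E ⟨ψ, hψS, hψ1, rfl⟩
    have h := hlow ψ hψS
    rw [hψ1, Complex.one_re, mul_one] at h
    exact h
  -- (2) the thermofield Rayleigh bound for `E(J)`
  have hR := tfd_rayleigh hA D P₁ P₂ h12 good hgood₁ hgood₂ S hS hc₁ hc₂ β J
  -- (3) the entropy price
  have hPwv : Pw *ᵥ v = v := by
    funext s
    rw [hPw, mulVec_diagonal]
    by_cases h : P₁ s ∨ P₂ s
    · rw [if_pos h, one_mul]
    · rw [if_neg h, zero_mul, hvP s fun h1 => h (Or.inl h1)]
  have hT := re_trace_proj_hamiltonian_gibbsWeight_le hA hPwH hPwPw hAPw ⟨v, hPwv, hv1, hva⟩ hβ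
  -- (4) `Z ≥ 0`, and assemble
  have hZ := re_trace_proj_gibbsWeight_nonneg hA hPwH hPwPw hAPw β
  have hE0Z := mul_le_mul_of_nonneg_right hE0 hZ
  rw [← hH₀, ← hK] at hR
  nlinarith [hR, hT, hE0Z, hZ]


/-! ### Registered form -/

/-- **Cold two-time pair coherence ⇒ linear Josephson gain, up to the entropy price** — closed (registered)
form of `tfd_gain_lower` (the abstract line of the crux idea `thermofield-double-purification`).  Lieb, PRL 62
(1989) 1201; Tasaki (2020) App. A; Koma–Tasaki, J. Stat. Phys. 76 (1994) 745. [folklore] -/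
theorem thermofieldDouble_gainLower : ∀ {n : Type} [Fintype n] [DecidableEq n] {A : Matrix n n ℂ} (D : Matrix n n ℂ) (P₁ P₂ : n → Prop) [DecidablePred P₁] [DecidablePred P₂] (good : n × n → Prop) (S : Submodule ℂ (n × n → ℂ)) (a β J : ℝ), A.IsHermitian → (∀ s, P₁ s → ¬ P₂ s) → (∀ s t, good (s, t) → (P₁ s ∧ P₁ t) ∨ (P₂ s ∧ P₂ t)) → (∀ s t, P₁ s → P₁ t → good (s, t)) → (∀ s t, P₂ s → P₂ t → good (s, t)) → (∀ ψ, ψ ∈ S ↔ ∀ p, ¬ good p → ψ p = 0) → Commute A (Matrix.diagonal fun s => if P₁ s then (1 : ℂ) else 0) → Commute A (Matrix.diagonal fun s => if P₂ s then (1 : ℂ) else 0) → (∀ v : n → ℂ, (∀ s, ¬ P₁ s → v s = 0) → a * (star v ⬝ᵥ v).re ≤ (star v ⬝ᵥ Matrix.mulVec A v).re) → (∀ v : n → ℂ, (∀ s, ¬ P₂ s → v s = 0) → a * (star v ⬝ᵥ v).re ≤ (star v ⬝ᵥ Matrix.mulVec A v).re) → (∃ v : n → ℂ, (∀ s, ¬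 P₁ s → v s = 0) ∧ star v ⬝ᵥ v = 1 ∧ (star v ⬝ᵥ Matrix.mulVec A v).re ≤ a) → 0 < β → 2 * J * ((Matrix.diagonal fun s => if P₁ s ∨ P₂ s then (1 : ℂ) else 0) * Matrix.gibbsWeight (β / 2) A * D * (Matrix.diagonal fun s => if P₁ s ∨ P₂ s then (1 : ℂ) else 0) * Matrix.gibbsWeight (β / 2) A * Matrix.conjTranspose D).trace.re - 2 * (Real.log (Fintype.card n) / β) * ((Matrix.diagonal fun s => if P₁ s ∨ P₂ s then (1 : ℂ) else 0) * Matrix.gibbsWeight β A).trace.re ≤ ((Matrix.kroneckerMap (fun a b : ℂ => a * b) A 1 + Matrix.kroneckerMap (fun a b : ℂ => a * b) 1 (Matrix.transpose A) - ((0 : ℝ) : ℂ) • (Matrix.kroneckerMap (fun a b : ℂ => a * b) D (Matrix.transpose (Matrix.conjTranspose D)) + Matrix.kroneckerMap (fun a b : ℂ => a * b) (Matrix.conjTranspose D) (Matrix.transpose D))).minEnergyOn S - (Matrix.kroneckerMap (fun a b : ℂ => a * b) A 1 + Matrix.kroneckerMap (fun a b : ℂ => a * b) 1 (Matrix.transpose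 A) - (J : ℂ) • (Matrix.kroneckerMap (fun a b : ℂ => a * b) D (Matrix.transpose (Matrix.conjTranspose D)) + Matrix.kroneckerMap (fun a b : ℂ => a * b) (Matrix.conjTranspose D) (Matrix.transpose D))).minEnergyOn S) * ((Matrix.diagonal fun s => if P₁ s ∨ P₂ s then (1 : ℂ) else 0) * Matrix.gibbsWeight β A).trace.re :=
  fun D P₁ P₂ _ _ good S a _ J hA h12 hgood hgood₁ hgood₂ hS hc₁ hc₂ hA₁ hA₂ hatt hβ =>
    tfd_gain_lower hA D P₁ P₂ h12 good hgood hgood₁ hgood₂ S hS hc₁ hc₂ a hA₁ hA₂ hatt hβ J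

end Summit.HubbardSuperconductivity.HubbardSuperconductivity.Theorems.JosephsonMirror
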